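import Summits.CriticalPhenomena.SAWScalingLimit.Theorems.SAWDevelopingMapHexTransferGMHexDictionaryDecode
import Summits.CriticalPhenomena.SAWScalingLimit.Theorems.SAWDevelopingMapHexTransferGMHexDictionaryMesh

/-!
# The `π/3` dictionary, part IV: hexagonal SAWs of the face domain ↦ Yang–Baxter walks

Helper file of the line `yb-relay` for the crux `HexTransfer` (stmt-CriticalPhenomena-14221), stub
`stub_gmHexDictionary`. Gluing the combinatorial files (`…Walks`, `…Inverse`, `…Decode`, in the
coordinate honeycomb `HV`) to the geometric ones (`…Geometry`, `…Mesh`, in `HexVertex`) along the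
graph isomorphism `chart : hexGraph ≃g hvGraph` (`hvIso` followed by the central flip, so that
`chart (triWN f) = f.hv W`, `chart (triSE f) = f.hv S`):

* **`hexToYB`** — the map `φ` of the dictionary: a self-avoiding walk of the canonical discretisation
  of `faceDomain Ω δ a` from `bdryVertex a` to `bdryVertex b` ↦ the Yang–Baxter walk of `Ω_δ` from
  `a` to `b` crossing the sides dual to its edges (`decodeWalk` of its support);
* `weight_hexToYB` (`w_{π/3}(φ γ) = x_c^{ℓ(γ)}`), `hvInner_hexToYB`, `hexToYB_injective`,
  `exists_hexToYB_eq` (every walk of nonzero weight is a `φ γ`).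

[cite: GlazmanManolescu2019, §1 p. 3, Fig. 2]; elementary statements tagged [folklore].
-/

noncomputable section

namespace Summit.CriticalPhenomena.SAWScalingLimit.Cruxes.HexTransfer.YbRelay

open Set
open Literature.Probability.LatticeModels
open Literature.Probability.RandomPlanarGeometry
open Literature.Probability.RandomPlanarGeometry.SAW
open Literature.Probability.RandomPlanarGeometry.SAW.YangBaxter

/-! ### The chart `HexVertex ≃ HV` adapted to the tiling -/

/-- The graph isomorphism `hexGraph ≃g hvGraph` sending the triangle `W–N` of the rhombus `f` to
`f.hv W` and the triangle `S–E` to `f.hv S`: `hvIso` followed by the central flip of `ℍ`. [folklore] -/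
def chart : hexGraph ≃g hvGraph := hvIso.trans HV.flip

/-- Pointwise formula for the chart. [folklore] -/
theorem chart_apply (v : HexVertex) : chart v = (-(v.1 0), -(v.1 1) - 1, !decide (v.2 = 1)) := rfl

/-- The rhombus of `chart v` is the rhombus of `v`. [folklore] -/
@[simp] theorem faceHV_chart (v : HexVertex) : faceHV (chart v) = gmFace v := by
  simp [chart_apply, faceHV, gmFace]

/-- `chart (triWN f) = f.hv W`. [folklore] -/
@[simp] theorem chart_triWN (f : Face) : chart (triWN f) = f.hv .W := by
  obtain ⟨k, j⟩ := f
  simp [chart_apply, triWN, Face.hv, Side.tri]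

/-- `chart (triSE f) = f.hv S`. [folklore] -/
@[simp] theorem chart_triSE (f : Face) : chart (triSE f) = f.hv .S := by
  obtain ⟨k, j⟩ := f
  simp [chart_apply, triSE, Face.hv, Side.tri]

/-- The chart carries `triAt` to `hvAt`. [folklore] -/
theorem chart_triAt (g : Face) (e : MidEdge) : chart (triAt g e) = hvAt g e := by
  unfold triAt hvAt
  split_ifs <;> simp

/-- The chart carries the boundary vertex of `e` to the `HV` triangle resting on `e`. [folklore] -/
theorem chart_bdryVertex (Δ : Set Face) (e : MidEdge) : chart (bdryVertex Δ e) = hvAt (inclFace Δ e) e :=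
  chart_triAt _ _

/-- The rhombus of the boundary vertex of `e` is `inclFace Δ e`. [folklore] -/
theorem gmFace_bdryVertex (Δ : Set Face) (e : MidEdge) : gmFace (bdryVertex Δ e) = inclFace Δ e := by
  rw [← faceHV_chart, chart_bdryVertex]
  unfold hvAt
  split_ifs <;> simp

section Dictionary

variable {Ω : Set ℂ} {δ : ℝ} (hδ : δ ≠ 0) {a b : MidEdge} (ha : IsBdryEdge (meshFaces third Ω δ) a)
  (hb : IsBdryEdge (meshFaces third Ω δ) b) (hab : a ≠ b)

/-! ### The support of a SAW of the face domain in the chart -/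

include hδ in
/-- Along a walk of the canonical discretisation of the face domain, all rhombi lie in the face
component (given that the first one does). [folklore] -/
theorem gmFace_mem_of_mem_support {u w : HexVertex} (q : (hexDomainGraph (faceDomain Ω δ a) δ).Walk u w)
    (hu : gmFace u ∈ faceComp (meshFaces third Ω δ) a) :
    ∀ x ∈ q.support, gmFace x ∈ faceComp (meshFaces third Ω δ) a := by
  induction q with
  | nil => intro x hx; rw [SimpleGraph.Walk.support_nil, List.mem_singleton] at hx; rwa [hx]
  | cons h q ih =>
    intro x hx
    rw [SimpleGraph.Walk.support_cons, List.mem_cons] at hx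
    rcases hx with rfl | hx
    · exact hu
    · exact ih ((hexDomainGraph_faceDomain_adj_iff Ω hδ a _ _).1 h).2.2 x hx

include hδ in
/-- The support of a SAW of the face domain from `bdryVertex a`, read in the chart, is a self-avoiding
honeycomb path through triangles of rhombi of `Ω_δ`, from the triangle resting on `a` to the one
resting on `b`. [folklore] -/
theorem support_chart_spec (ha : IsBdryEdge (meshFaces third Ω δ) a)
    (γ : HexDomainSAW (faceDomain Ω δ a) δ (bdryVertex (meshFaces third Ω δ) a) (bdryVertex (meshFaces third Ω δ) b)) :
    (γ.walk.support.map chart).IsChain hvGraph.Adj ∧ (γ.walk.support.map chart).Nodup ∧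
      (γ.walk.support.map chart).head? = some (hvAt (inclFace (meshFaces third Ω δ) a) a) ∧
      (γ.walk.support.map chart).getLast? = some (hvAt (inclFace (meshFaces third Ω δ) b) b) ∧
      ∀ v ∈ γ.walk.support.map chart, faceHV v ∈ meshFaces third Ω δ := by
  refine ⟨?_, γ.isPath.support_nodup.map chart.injective, ?_, ?_, ?_⟩
  · rw [List.isChain_map]
    exact γ.walk.isChain_adj_support.imp fun x y h =>
      chart.map_rel_iff.2 ((hexDomainGraph_faceDomain_adj_iff Ω hδ a x y).1 h).1
  · rw [List.head?_map, ← γ.walk.cons_tail_support, List.head?_cons, Option.map_some, chart_bdryVertex]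
  · rw [List.getLast?_map, List.getLast?_eq_some_getLast γ.walk.support_ne_nil, γ.walk.getLast_support,
      Option.map_some, chart_bdryVertex]
  · intro v hv
    obtain ⟨x, hx, rfl⟩ := List.mem_map.1 hv
    rw [faceHV_chart]
    exact (gmFace_mem_of_mem_support hδ γ.walk (by rw [gmFace_bdryVertex]; exact ⟨ha.inclFace_spec.1, .refl _⟩) x hx).1

include hδ in
/-- **The map `φ` of the dictionary**: a self-avoiding walk of the canonical hexagonal discretisation
of the face domain, from the boundary vertex of `a` to that of `b`, is sent to the Yang–Baxter walk of
`Ω_δ` from `a` to `b` crossing `a`, the sides dual to its edges, and `b`.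
[cite: GlazmanManolescu2019, §1 p. 3, Fig. 2] -/
def hexToYB (γ : HexDomainSAW (faceDomain Ω δ a) δ (bdryVertex (meshFaces third Ω δ) a)
    (bdryVertex (meshFaces third Ω δ) b)) : YangBaxterSAW third Ω δ a b :=
  decodeWalk ha hb hab (support_chart_spec hδ ha γ).1 (support_chart_spec hδ ha γ).2.1
    (support_chart_spec hδ ha γ).2.2.1 (support_chart_spec hδ ha γ).2.2.2.1 (support_chart_spec hδ ha γ).2.2.2.2

include hδ in
/-- The mid-edges crossed by `φ γ`. [folklore] -/
theorem hexToYB_mids (γ : HexDomainSAW (faceDomain Ω δ a) δ (bdryVertex (meshFaces third Ω δ) a)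
    (bdryVertex (meshFaces third Ω δ) b)) :
    (hexToYB hδ ha hb hab γ).mids = a :: (YBWalk.pairEdges (γ.walk.support.map chart) ++ [b]) := rfl

include hδ in
/-- **The triangle list of `φ γ` is the support of `γ`** (in the chart). [cite: GlazmanManolescu2019, §1 p. 3, Fig. 2] -/
theorem hvInner_hexToYB (γ : HexDomainSAW (faceDomain Ω δ a) δ (bdryVertex (meshFaces third Ω δ) a)
    (bdryVertex (meshFaces third Ω δ) b)) :
    (hexToYB hδ ha hb hab γ).hvInner = γ.walk.support.map chart :=
  hvInner_decodeWalk ha hb hab _ _ _ _ _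

include hδ in
/-- **`w_{π/3}(φ γ) = x_c^{ℓ(γ)}`**: the Yang–Baxter weight of `φ γ` is the critical hexagonal weight of
`γ` (`ℓ` = number of vertices). [cite: GlazmanManolescu2019, §1 p. 3 ("with weight (1/√(2+√2))^{|γ|}")] -/
theorem weight_hexToYB (γ : HexDomainSAW (faceDomain Ω δ a) δ (bdryVertex (meshFaces third Ω δ) a)
    (bdryVertex (meshFaces third Ω δ) b)) :
    (hexToYB hδ ha hb hab γ).weight third = hexCriticalFugacity ^ γ.vertexCount := by
  rw [EmbDomainSAW.vertexCount, EmbDomainSAW.length, ← SimpleGraph.Walk.length_support,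
    ← List.length_map (f := chart)]
  exact weight_decodeWalk ha hb hab _ _ _ _ _

include hδ in
/-- **`φ` is injective** (the support of `γ` is the triangle list of `φ γ`). [folklore] -/
theorem hexToYB_injective : Function.Injective (hexToYB hδ ha hb hab) := by
  intro γ γ' h
  have hs : γ.walk.support = γ'.walk.support := by
    have h1 := hvInner_hexToYB hδ ha hb hab γ
    rw [h, hvInner_hexToYB hδ ha hb hab γ'] at h1
    exact List.map_injective_iff.2 chart.injective h1.symm
  obtain ⟨w, hw⟩ := γ
  obtain ⟨w', hw'⟩ := γ'
  simp only at hs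
  cases SimpleGraph.Walk.ext_support hs
  rfl

include hδ in
/-- **Every Yang–Baxter walk of nonzero weight between the boundary edges is a `φ γ`**: its triangle
list, pulled back by the chart, is a self-avoiding walk of the face domain between the boundary
vertices. [cite: GlazmanManolescu2019, §1 p. 3, Fig. 2] -/
theorem exists_hexToYB_eq (γ : YangBaxterSAW third Ω δ a b) (hw : γ.weight third ≠ 0) :
    ∃ γ', hexToYB hδ ha hb hab γ' = γ := by
  have hnd : γ.hvInner.Nodup := YBWalk.nodup_hvUpTo hw le_rfl
  have hne' : γ.hvInner ≠ [] := YBWalk.hvUpTo_ne_nil (YBWalk.arcs_length_pos γ hab)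
  have hne : γ.hvInner.map chart.symm ≠ [] := by simpa using hne'
  have hmem : ∀ x ∈ γ.hvInner.map chart.symm, gmFace x ∈ faceComp (meshFaces third Ω δ) a := by
    intro x hx
    obtain ⟨u, hu, rfl⟩ := List.mem_map.1 hx
    rw [← faceHV_chart, RelIso.apply_symm_apply]
    exact reachable_faceHV_of_mem_hvInner ha γ hu
  have hchain : (γ.hvInner.map chart.symm).IsChain (hexDomainGraph (faceDomain Ω δ a) δ).Adj := by
    rw [List.isChain_map]
    refine List.IsChain.imp_of_mem_imp ?_ (YBWalk.isChain_hvUpTo le_rfl)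
    intro u u' hu hu' h
    refine (hexDomainGraph_faceDomain_adj_iff Ω hδ a _ _).2 ⟨chart.symm.map_rel_iff.2 h, ?_, ?_⟩
    · exact hmem _ (List.mem_map_of_mem hu)
    · exact hmem _ (List.mem_map_of_mem hu')
  have hh : γ.hvInner.head hne' = hvAt (inclFace (meshFaces third Ω δ) a) a := by
    apply Option.some_injective
    rw [← List.head?_eq_some_head, head?_hvInner ha hab γ]
  have hl : γ.hvInner.getLast hne' = hvAt (inclFace (meshFaces third Ω δ) b) b := by
    apply Option.some_injective
    rw [← List.getLast?_eq_some_getLast, getLast?_hvInner hb hab γ]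
  have hhead : (γ.hvInner.map chart.symm).head hne = bdryVertex (meshFaces third Ω δ) a := by
    rw [List.head_map, hh, ← chart_bdryVertex, RelIso.symm_apply_apply]
  have hlast : (γ.hvInner.map chart.symm).getLast hne = bdryVertex (meshFaces third Ω δ) b := by
    rw [List.getLast_map, hl, ← chart_bdryVertex, RelIso.symm_apply_apply]
  refine ⟨⟨(SimpleGraph.Walk.ofSupport _ hne hchain).copy hhead hlast, ?_⟩, ?_⟩
  · refine SimpleGraph.Walk.IsPath.mk' ?_
    rw [SimpleGraph.Walk.support_copy, SimpleGraph.Walk.support_ofSupport]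
    exact hnd.map chart.symm.injective
  · apply YBWalk.ext
    have hsupp : ((SimpleGraph.Walk.ofSupport _ hne hchain).copy hhead hlast).support.map chart = γ.hvInner := by
      rw [SimpleGraph.Walk.support_copy, SimpleGraph.Walk.support_ofSupport, List.map_map]
      conv_rhs => rw [← List.map_id γ.hvInner]
      exact List.map_congr_left fun u _ => RelIso.apply_symm_apply chart u
    rw [hexToYB_mids, hsupp]
    exact congrArg YBWalk.mids (decodeWalk_hvInner ha hb hab γ hnd)

end Dictionary

/-- **Main statement of this file (registered sub-goal of `stub_gmHexDictionary`)**: every Yang–Baxter walk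
of nonzero weight between the boundary edges is the image under `φ = hexToYB` of a self-avoiding walk of
the face domain. [cite: GlazmanManolescu2019, §1 p. 3, Fig. 2] -/
theorem exists_hexToYB_eq_of_weight_ne_zero : ∀ {Ω : Set ℂ} {δ : ℝ} (hδ : δ ≠ 0) {a b : MidEdge} (ha : IsBdryEdge (meshFaces third Ω δ) a) (hb : IsBdryEdge (meshFaces third Ω δ) b) (hab : a ≠ b) (γ : YangBaxterSAW third Ω δ a b), γ.weight third ≠ 0 → ∃ γ', hexToYB hδ ha hb hab γ' = γ := by
  intro Ω δ hδ a b ha hb hab γ hw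
  exact exists_hexToYB_eq hδ ha hb hab γ hw

end Summit.CriticalPhenomena.SAWScalingLimit.Cruxes.HexTransfer.YbRelay

end
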